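import Summits.QuantumFields.YangMills.Theorems.AtomicCalibrationRSmearedAtomicBoundPieces
import HarnessLib

/-!
# Tempered E3 (stub E3T of leaf 19868), part 1/3 — the PRODUCT form of item 28168's clause by homogeneity, and the
tensor atom's joint moment under TEMPERED atom ceilings

Free-hands helper toward the registered stub E3T `stub_temperedMomentBoundA : WhitneyPkgW → AtomicSqrtDominationR →
TemperedMomentBoundA` of LINES «TemperedPeak» REV 2 / «OctaveDoubling» REV 2.1 on the leaf
`InfiniteVolumeContinuum.HypercubicOSDataFromInfiniteVolume` (stmt-QuantumFields-19868).

* `sqrtDomClause_prod` — item 28168's ∀-clause (`SqrtDomClause`, one common level `b` for all clusters) implies the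
  PRODUCT form `|E ∏ A_i| ≤ (C n^θ)ⁿ ∏_i √b_i` for per-cluster levels `b_i > 0`, by HOMOGENEITY: rescale each
  cluster's weights by `(√b_i)⁻¹` (its RP square becomes `≤ 1`) and apply the clause at level `1`.
* `tensorAtom_moment_le_tempered` — twin of E3's H4 `tensorAtom_moment_le`: the E1 ceilings (`AtomCeilings` + onset
  domination, uniform level `ε`) are replaced by TMB-A's CEILING-FORM HYPOTHESIS at the atom's own scale, level
  `ε (s/a)^M` for a lattice atom of scale `s = a/σ`, i.e. `ε (σ^M)⁻¹` for a tensor-atom slot of physical size `σ`;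
  the separating plane (E3's H3 `separating_plane`) and the currency matching are unchanged; conclusion
  `|joint moment| ≤ (C n^θ √ε)ⁿ ∏_l (√(σ_l^M))⁻¹`.

HONEST LABEL: helper lemmas toward a registered side stub (E3T) of two DRAFT lines; item 28168 enters only as a
HYPOTHESIS (its clause); no crux / rung / leaf / summit is proved; YM mass gap NOT proved.
-/

set_option autoImplicit false
noncomputable section
open scoped BigOperators
open MeasureTheory Filter Topology
open Literature.MathematicalPhysics.QuantumFieldTheory Literature.MathematicalPhysics.QuantumLattice
open Literature.Probability.LatticeModels (Site)
open Summit.QuantumFields.YangMills.Theorems.InfiniteVolume (stateMomentStr)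
open Summit.QuantumFields.YangMills.Theorems.InfVolRP (centreOffset)
open Summit.QuantumFields.YangMills.Theses.OnsetTautology
open Summit.QuantumFields.YangMills.Cruxes.AtomicCalibrationR.MirrorCalibration

namespace Summit.QuantumFields.YangMills.Theorems.TemperedMomentBound

variable {G : Type} [Group G] [TopologicalSpace G] [MeasurableSpace G]

/-! ## §1 Product form of 28168's clause by homogeneity -/

/-- **Product form of item 28168's clause.**  If the clusters `A_i = Σ_p w_i(p)(…)` are pairwise plane-separated
with BOTH reflection-positivity squares across the separating plane `≤ b_i` resp. `≤ b_j` (per-cluster levels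
`b_i > 0`), then `|E_μ ∏ A_i| ≤ (C n^θ)ⁿ ∏_i √b_i`.  Proof: the clause is applied at the common level `1` to the
rescaled weights `(√b_i)⁻¹ w_i` (RP squares are quadratic, the joint moment is multilinear). -/
theorem sqrtDomClause_prod (r : LatticeRep G) (μ : Measure (LGConfig 4 G)) {C θ : ℝ}
    (h68 : SqrtDomClause r μ C θ) {n : ℕ} (S : Fin n → Finset ((Fin 4 × Fin 4) × (Fin 4 → ℤ)))
    (w : Fin n → (Fin 4 × Fin 4) × (Fin 4 → ℤ) → ℝ) (bl : Fin n → ℝ) (hn : 2 ≤ n) (hbl : ∀ i, 0 < bl i)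
    (hval : ∀ i, ∀ p ∈ S i, p.1.1 < p.1.2)
    (hsep : ∀ i j, i ≠ j → ∃ (k : Fin 4) (c : ℤ),
      (((∀ p ∈ S i, p.2 k + 2 ≤ c) ∧ (∀ p ∈ S j, c + 2 ≤ p.2 k)) ∨
          ((∀ p ∈ S j, p.2 k + 2 ≤ c) ∧ (∀ p ∈ S i, c + 2 ≤ p.2 k))) ∧
        ∑ p ∈ S i, ∑ p' ∈ S i, w i p * w i p' * stateMomentStr G r μ 2 ![p.1, p'.1]
            ![(fun l => if l = k then 2 * c - p.2 l - (if p.1.1 = k ∨ p.1.2 = k then 1 else 0) else p.2 l), p'.2] ≤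
          bl i ∧
        ∑ p ∈ S j, ∑ p' ∈ S j, w j p * w j p' * stateMomentStr G r μ 2 ![p.1, p'.1]
            ![(fun l => if l = k then 2 * c - p.2 l - (if p.1.1 = k ∨ p.1.2 = k then 1 else 0) else p.2 l), p'.2] ≤
          bl j) :
    |∑ p ∈ Fintype.piFinset S, (∏ i, w i (p i)) * stateMomentStr G r μ n (fun i => (p i).1) (fun i => (p i).2)| ≤
      (C * n ^ θ) ^ n * ∏ i, Real.sqrt (bl i) := by
  classical
  -- the rescaling factors
  set lam : Fin n → ℝ := fun i => (Real.sqrt (bl i))⁻¹ with hlam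
  have hsq : ∀ i, 0 < Real.sqrt (bl i) := fun i => Real.sqrt_pos.2 (hbl i)
  have hlam0 : ∀ i, 0 < lam i := fun i => inv_pos.2 (hsq i)
  have hlam2 : ∀ i, lam i * lam i * bl i = 1 := fun i => by
    have h := Real.mul_self_sqrt (hbl i).le
    show (Real.sqrt (bl i))⁻¹ * (Real.sqrt (bl i))⁻¹ * bl i = 1
    rw [← mul_inv, h, inv_mul_cancel₀ (hbl i).ne']
  -- the rescaled weights
  set w' : Fin n → (Fin 4 × Fin 4) × (Fin 4 → ℤ) → ℝ := fun i p => lam i * w i p with hw'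
  -- rescaled RP squares
  have hRP : ∀ (i : Fin n) (k : Fin 4) (c : ℤ),
      ∑ p ∈ S i, ∑ p' ∈ S i, w' i p * w' i p' * stateMomentStr G r μ 2 ![p.1, p'.1]
          ![(fun l => if l = k then 2 * c - p.2 l - (if p.1.1 = k ∨ p.1.2 = k then 1 else 0) else p.2 l), p'.2] =
        lam i * lam i * ∑ p ∈ S i, ∑ p' ∈ S i, w i p * w i p' * stateMomentStr G r μ 2 ![p.1, p'.1]
          ![(fun l => if l = k then 2 * c - p.2 l - (if p.1.1 = k ∨ p.1.2 = k then 1 else 0) else p.2 l), p'.2] := by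
    intro i k c
    rw [Finset.mul_sum]
    refine Finset.sum_congr rfl fun p _ => ?_
    rw [Finset.mul_sum]
    refine Finset.sum_congr rfl fun p' _ => ?_
    simp only [hw']
    ring
  have hRP1 : ∀ (i : Fin n) (k : Fin 4) (c : ℤ),
      ∑ p ∈ S i, ∑ p' ∈ S i, w i p * w i p' * stateMomentStr G r μ 2 ![p.1, p'.1]
          ![(fun l => if l = k then 2 * c - p.2 l - (if p.1.1 = k ∨ p.1.2 = k then 1 else 0) else p.2 l), p'.2] ≤
        bl i →
      ∑ p ∈ S i, ∑ p' ∈ S i, w' i p * w' i p' * stateMomentStr G r μ 2 ![p.1, p'.1]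
          ![(fun l => if l = k then 2 * c - p.2 l - (if p.1.1 = k ∨ p.1.2 = k then 1 else 0) else p.2 l), p'.2] ≤
        1 := by
    intro i k c hle
    rw [hRP]
    calc lam i * lam i * _ ≤ lam i * lam i * bl i :=
          mul_le_mul_of_nonneg_left hle (mul_pos (hlam0 i) (hlam0 i)).le
      _ = 1 := hlam2 i
  -- 28168 at level 1 for the rescaled clusters
  have h1 := h68 n S w' 1 hn one_pos hval (fun i j hij => by
    obtain ⟨k, c, hside, hi, hj⟩ := hsep i j hij
    exact ⟨k, c, hside, hRP1 i k c hi, hRP1 j k c hj⟩)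
  rw [Real.sqrt_one, mul_one] at h1
  -- the joint moment is multilinear
  have hprod : ∀ p : Fin n → (Fin 4 × Fin 4) × (Fin 4 → ℤ), ∏ i, w' i (p i) = (∏ i, lam i) * ∏ i, w i (p i) := by
    intro p
    rw [← Finset.prod_mul_distrib]
  have hsum : ∑ p ∈ Fintype.piFinset S, (∏ i, w' i (p i)) * stateMomentStr G r μ n (fun i => (p i).1)
      (fun i => (p i).2) = (∏ i, lam i) * ∑ p ∈ Fintype.piFinset S, (∏ i, w i (p i)) *
        stateMomentStr G r μ n (fun i => (p i).1) (fun i => (p i).2) := by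
    rw [Finset.mul_sum]
    refine Finset.sum_congr rfl fun p _ => ?_
    rw [hprod]; ring
  rw [hsum, abs_mul, abs_of_pos (Finset.prod_pos fun i _ => hlam0 i)] at h1
  have hL : 0 < ∏ i, lam i := Finset.prod_pos fun i _ => hlam0 i
  have hLinv : (∏ i, lam i)⁻¹ = ∏ i, Real.sqrt (bl i) := by
    rw [← Finset.prod_inv_distrib]
    exact Finset.prod_congr rfl fun i _ => by rw [hlam, inv_inv]
  rw [← hLinv, ← div_eq_mul_inv, le_div_iff₀ hL, mul_comm]
  exact h1

/-! ## §2 The tensor atom's joint moment under tempered atom ceilings -/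

/-- **Tempered H4 `tensorAtom_moment_le_tempered`.**  A tensor atom of one LARGE Whitney piece (radius `ρ ≥ a`, slots
`Λρ`-separated, `Λ ≥ 4t + 12`; atom sizes `σ_l ≤ ρ`, `σ_l < 1`, centres within `2ρ`), sampled on the lattice of
spacing `a`, with `S_l` = the exact carriers: the separating plane (E3's H3) puts every pair of slots in the far-mirror
regime, the TEMPERED ceiling-form hypothesis (TMB-A's, at the atom's own scale `s_l = a/σ_l`, level
`ε (s_l/a)^M = ε (σ_l^M)⁻¹`) bounds both RP squares, and the product form of 28168's clause gives
`|joint moment| ≤ (C n^θ √ε)ⁿ ∏_l (√(σ_l^M))⁻¹`. -/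
theorem tensorAtom_moment_le_tempered (r : LatticeRep G) (C θ : ℝ) (μ : Measure (LGConfig 4 G))
    (h68 : SqrtDomClause r μ C θ) (b : SchwartzMap (EuclideanSpace ℝ (Fin 4)) ℝ) (t ε a ρ Λ : ℝ) (M : ℕ)
    (ht : 0 ≤ t) (hbt : ∀ u, b u ≠ 0 → ‖u‖ ≤ t) (hε : 0 < ε) (ha : 0 < a)
    (hT : ∀ (S : Finset ((Fin 4 × Fin 4) × (Fin 4 → ℤ))) (q : Fin 4 × Fin 4) (s t : ℝ) (y : EuclideanSpace ℝ (Fin 4))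
      (k : Fin 4) (c : ℤ), q.1 < q.2 → 0 < s → a < s → (∀ u, b u ≠ 0 → ‖u‖ ≤ t) →
      (∀ p, atomWt b {q} s y p ≠ 0 → p ∈ S) →
      ((∀ p ∈ S, ((p.2 k : ℤ) : ℝ) + t / s + 2 ≤ (c : ℝ)) ∨ (∀ p ∈ S, (c : ℝ) + t / s + 2 ≤ ((p.2 k : ℤ) : ℝ))) →
      ∑ p ∈ S, ∑ p' ∈ S, atomWt b {q} s y p * atomWt b {q} s y p' *
          stateMomentStr G r μ 2 ![p.1, p'.1] ![reflSite k c p, p'.2] ≤ ε * (s / a) ^ M)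
    (hρa : a ≤ ρ) (hΛ : 4 * t + 12 ≤ Λ)
    {n : ℕ} (q : Fin n → Fin 4 × Fin 4) (σ : Fin n → ℝ) (η c : Fin n → EuclideanSpace ℝ (Fin 4))
    (S : Fin n → Finset ((Fin 4 × Fin 4) × (Fin 4 → ℤ)))
    (hn : 2 ≤ n) (hq : ∀ l, (q l).1 < (q l).2) (hσ : ∀ l, 0 < σ l ∧ σ l ≤ ρ ∧ σ l < 1)
    (hη : ∀ l, ‖η l - c l‖ ≤ 2 * ρ) (hsep : ∀ l l', l ≠ l' → ∃ k : Fin 4, Λ * ρ ≤ |c l k - c l' k|)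
    (hS : ∀ l p, atomWt b {q l} (a / σ l) ((σ l)⁻¹ • η l) p ≠ 0 → p ∈ S l)
    (hSne : ∀ l, ∀ p ∈ S l, atomWt b {q l} (a / σ l) ((σ l)⁻¹ • η l) p ≠ 0) :
    |∑ p ∈ Fintype.piFinset S, (∏ l, atomWt b {q l} (a / σ l) ((σ l)⁻¹ • η l) (p l)) *
        stateMomentStr G r μ n (fun l => (p l).1) (fun l => (p l).2)| ≤
      (C * n ^ θ * Real.sqrt ε) ^ n * ∏ l, (Real.sqrt ((σ l) ^ M))⁻¹ := by
  have hval : ∀ l, ∀ p ∈ S l, (p.1 ∈ ({q l} : Finset (Fin 4 × Fin 4)) ∧ p.1.1 < p.1.2) := fun l p hp =>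
    ((atomWt_ne_zero_iff b {q l} (a / σ l) ((σ l)⁻¹ • η l) p).1 (hSne l p hp)).1
  -- per-slot levels
  set bl : Fin n → ℝ := fun l => ε * ((σ l) ^ M)⁻¹ with hbl
  have hσM : ∀ l, 0 < (σ l) ^ M := fun l => pow_pos (hσ l).1 M
  have hbl0 : ∀ l, 0 < bl l := fun l => mul_pos hε (inv_pos.2 (hσM l))
  have hlev : ∀ l, ε * ((a / σ l) / a) ^ M = bl l := fun l => by
    have e : (a / σ l) / a = (σ l)⁻¹ := by
      field_simp
    show ε * ((a / σ l) / a) ^ M = ε * ((σ l) ^ M)⁻¹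
    rw [e, inv_pow]
  -- the product form with these levels
  have hmain := sqrtDomClause_prod r μ h68 S (fun l => atomWt b {q l} (a / σ l) ((σ l)⁻¹ • η l)) bl hn hbl0
    (fun i p hp => (hval i p hp).2) ?_
  · refine hmain.trans (le_of_eq ?_)
    have hsb : ∀ l, Real.sqrt (bl l) = Real.sqrt ε * (Real.sqrt ((σ l) ^ M))⁻¹ := fun l => by
      rw [hbl, Real.sqrt_mul hε.le, Real.sqrt_inv]
    simp_rw [hsb]
    rw [Finset.prod_mul_distrib, Finset.prod_const, Finset.card_univ, Fintype.card_fin, mul_pow, mul_pow]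
    ring
  -- the separating planes and the tempered ceilings
  intro i j hij
  obtain ⟨k, hk⟩ := hsep i j hij
  obtain ⟨cz, hcz⟩ := separating_plane ht hbt ha hρa hΛ (hσ i).1 (hσ i).2.1 (hσ j).1 (hσ j).2.1 (hη i) (hη j)
    hk (q i) (q j)
  -- the tempered ceiling for cluster `l` on either side of the plane `x_k = cz`
  have hE : ∀ l, ((∀ p ∈ S l, ((p.2 k : ℤ) : ℝ) + t / (a / σ l) + 2 ≤ (cz : ℝ)) ∨
      (∀ p ∈ S l, (cz : ℝ) + t / (a / σ l) + 2 ≤ ((p.2 k : ℤ) : ℝ))) →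
      ∑ p ∈ S l, ∑ p' ∈ S l, atomWt b {q l} (a / σ l) ((σ l)⁻¹ • η l) p *
          atomWt b {q l} (a / σ l) ((σ l)⁻¹ • η l) p' *
        stateMomentStr G r μ 2 ![p.1, p'.1] ![reflSite k cz p, p'.2] ≤ bl l := fun l hside => by
    rw [← hlev l]
    exact hT (S l) (q l) (a / σ l) t ((σ l)⁻¹ • η l) k cz (hq l) (div_pos ha (hσ l).1)
      (by rw [lt_div_iff₀ (hσ l).1]; nlinarith [(hσ l).2.2]) hbt (hS l) hside
  -- integer clauses from the real ones (`t / s ≥ 0`)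
  have hZ1 : ∀ l (p : (Fin 4 × Fin 4) × (Fin 4 → ℤ)), ((p.2 k : ℤ) : ℝ) + t / (a / σ l) + 2 ≤ (cz : ℝ) →
      p.2 k + 2 ≤ cz := fun l p h => by
    have h0 : 0 ≤ t / (a / σ l) := div_nonneg ht (div_pos ha (hσ l).1).le
    have : ((p.2 k : ℤ) : ℝ) + 2 ≤ (cz : ℝ) := by linarith
    exact_mod_cast this
  have hZ2 : ∀ l (p : (Fin 4 × Fin 4) × (Fin 4 → ℤ)), (cz : ℝ) + t / (a / σ l) + 2 ≤ ((p.2 k : ℤ) : ℝ) →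
      cz + 2 ≤ p.2 k := fun l p h => by
    have h0 : 0 ≤ t / (a / σ l) := div_nonneg ht (div_pos ha (hσ l).1).le
    have : (cz : ℝ) + 2 ≤ ((p.2 k : ℤ) : ℝ) := by linarith
    exact_mod_cast this
  rcases hcz with ⟨h1, h2⟩ | ⟨h1, h2⟩
  · have s1 : ∀ p ∈ S i, ((p.2 k : ℤ) : ℝ) + t / (a / σ i) + 2 ≤ (cz : ℝ) := fun p hp => h1 p (hSne i p hp)
    have s2 : ∀ p ∈ S j, (cz : ℝ) + t / (a / σ j) + 2 ≤ ((p.2 k : ℤ) : ℝ) := fun p hp => h2 p (hSne j p hp)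
    exact ⟨k, cz, Or.inl ⟨fun p hp => hZ1 i p (s1 p hp), fun p hp => hZ2 j p (s2 p hp)⟩, hE i (Or.inl s1),
      hE j (Or.inr s2)⟩
  · have s1 : ∀ p ∈ S j, ((p.2 k : ℤ) : ℝ) + t / (a / σ j) + 2 ≤ (cz : ℝ) := fun p hp => h1 p (hSne j p hp)
    have s2 : ∀ p ∈ S i, (cz : ℝ) + t / (a / σ i) + 2 ≤ ((p.2 k : ℤ) : ℝ) := fun p hp => h2 p (hSne i p hp)
    exact ⟨k, cz, Or.inr ⟨fun p hp => hZ1 j p (s1 p hp), fun p hp => hZ2 i p (s2 p hp)⟩, hE i (Or.inr s2),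
      hE j (Or.inl s1)⟩

end Summit.QuantumFields.YangMills.Theorems.TemperedMomentBound

end
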